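import Summits.AnomalousDissipation.AnomalousDissipation.Theorems.TaylorCertificatesKolmogorovFloorResponseDefs

/-!
# LINE-BOUNDS tools, part 1: window sums and the integer symbols (line `Sketch`, crux stmt-AnomalousDissipation-15122)

Elementary finite-sum inequalities used by the LINE-BOUNDS stub `lineBounds`:

* `Σ_{i ≤ n} 1/(2i+1)² ≤ 5/4`, `Σ_{i ≤ n} 1/(2i+1) ≤ 1 + log(2n+1)`, and the telescoping majorant
  `Σ_{i ∈ S} (1/(2i−1)² + 1/(2i+1)²) ≤ 4/(2n₀−1)` for `S ⊆ [n₀, N)`, `n₀ ≥ 1` (used for the parity chain `P`);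
* the three window sums over `oddWindow J`: `Σ 1/|m| ≤ 2(1 + log(2J+1))`, `Σ 1/m² ≤ 4`, `# = 2J+2`;
* the integer lower bound `m²/4 ≤ |E_m|` at odd `m` (a nonzero integer at `|m| = 1`, `m² X2 ≤ 4E_m` beyond) and the
  sheet-sum bounds `|G₊|, |G₋| ≤ 4 · 5/4 = 5`.
-/

noncomputable section

set_option linter.dupNamespace false

open Finset
open scoped BigOperators

namespace Summit.AnomalousDissipation.AnomalousDissipation.Theorems.KolmogorovFloor.Response

/-! ## Window sums -/

/-- `Σ_{i ≤ n} 1/(2i+1)² ≤ 5/4 − 1/(4(n+1))`. -/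
theorem sum_range_inv_odd_sq_le (n : ℕ) :
    ∑ i ∈ range (n + 1), (1 : ℝ) / (2 * (i : ℝ) + 1) ^ 2 ≤ 5 / 4 - 1 / (4 * ((n : ℝ) + 1)) := by
  induction n with
  | zero => norm_num
  | succ n ih =>
    rw [sum_range_succ]
    have hn : (0 : ℝ) ≤ n := n.cast_nonneg
    have key : (1 : ℝ) / (2 * ((n : ℝ) + 1) + 1) ^ 2 ≤
        1 / (4 * ((n : ℝ) + 1)) - 1 / (4 * ((n : ℝ) + 1 + 1)) := by
      rw [div_sub_div _ _ (by positivity) (by positivity),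
        div_le_div_iff₀ (by positivity) (by positivity)]
      nlinarith
    push_cast at ih ⊢
    linarith

/-- `Σ_{i ≤ n} 1/(2i+1)² ≤ 5/4`. -/
theorem sum_range_inv_odd_sq_le' (n : ℕ) :
    ∑ i ∈ range (n + 1), (1 : ℝ) / (2 * (i : ℝ) + 1) ^ 2 ≤ 5 / 4 := by
  have h := sum_range_inv_odd_sq_le n
  have : (0 : ℝ) ≤ 1 / (4 * ((n : ℝ) + 1)) := by positivity
  linarith

/-- `Σ_{i ≤ n} 1/(2i+1) ≤ 1 + log(2n+1)`. -/
theorem sum_range_inv_odd_le_log (n : ℕ) :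
    ∑ i ∈ range (n + 1), (1 : ℝ) / (2 * (i : ℝ) + 1) ≤ 1 + Real.log (2 * (n : ℝ) + 1) := by
  induction n with
  | zero => simp
  | succ n ih =>
    rw [sum_range_succ]
    have hn : (0 : ℝ) ≤ n := n.cast_nonneg
    have hpos : (0 : ℝ) < 2 * n + 1 := by positivity
    have hpos' : (0 : ℝ) < 2 * ((n : ℝ) + 1) + 1 := by positivity
    have hlog : Real.log ((2 * ((n : ℝ) + 1) + 1) / (2 * n + 1)) =
        Real.log (2 * ((n : ℝ) + 1) + 1) - Real.log (2 * n + 1) :=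
      Real.log_div hpos'.ne' hpos.ne'
    have h1 : 1 - ((2 * ((n : ℝ) + 1) + 1) / (2 * n + 1))⁻¹ ≤
        Real.log ((2 * ((n : ℝ) + 1) + 1) / (2 * n + 1)) :=
      Real.one_sub_inv_le_log_of_pos (by positivity)
    have h2 : (1 : ℝ) / (2 * ((n : ℝ) + 1) + 1) ≤ 1 - ((2 * ((n : ℝ) + 1) + 1) / (2 * n + 1))⁻¹ := by
      rw [inv_div, div_le_iff₀ hpos', sub_mul, div_mul_cancel₀ _ hpos'.ne']
      linarith
    push_cast at ih ⊢
    linarith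

/-- The telescoping majorant for the parity chain: for `1 ≤ n₀ ≤ i`,
`Σ_{i ∈ S} (1/(2i−1)² + 1/(2i+1)²) ≤ 4/(2n₀ − 1)` whenever `S ⊆ [n₀, N)`. -/
theorem sum_inv_sq_pair_le (S : Finset ℕ) (n₀ N : ℕ) (hn₀ : 1 ≤ n₀)
    (hS : ∀ i ∈ S, n₀ ≤ i ∧ i < N) :
    ∑ i ∈ S, ((1 : ℝ) / (2 * (i : ℝ) - 1) ^ 2 + 1 / (2 * (i : ℝ) + 1) ^ 2) ≤
      4 / (2 * (n₀ : ℝ) - 1) := by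
  have hn₀' : (1 : ℝ) ≤ n₀ := by exact_mod_cast hn₀
  -- the telescoping sum over `Ico n₀ N'`
  have tele : ∀ N' : ℕ, n₀ ≤ N' →
      ∑ i ∈ Ico n₀ N', ((1 : ℝ) / (2 * (i : ℝ) - 1) - 1 / (2 * (i : ℝ) + 1)) =
        1 / (2 * (n₀ : ℝ) - 1) - 1 / (2 * (N' : ℝ) - 1) := by
    intro N' hN'
    induction N', hN' using Nat.le_induction with
    | base => simp
    | succ N' hN' ih =>
      rw [sum_Ico_succ_top hN', ih]
      push_cast
      ring
  -- pointwise majorant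
  have pt : ∀ i : ℕ, n₀ ≤ i →
      (1 : ℝ) / (2 * (i : ℝ) - 1) ^ 2 + 1 / (2 * (i : ℝ) + 1) ^ 2 ≤
        4 * (1 / (2 * (i : ℝ) - 1) - 1 / (2 * (i : ℝ) + 1)) := by
    intro i hi
    have hi' : (1 : ℝ) ≤ i := by exact_mod_cast le_trans hn₀ hi
    have h1 : (0 : ℝ) < 2 * (i : ℝ) - 1 := by linarith
    have h2 : (0 : ℝ) < 2 * (i : ℝ) + 1 := by linarith
    rw [div_add_div _ _ (by positivity) (by positivity), div_sub_div _ _ h1.ne' h2.ne',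
      mul_div_assoc', div_le_div_iff₀ (by positivity) (by positivity)]
    nlinarith [mul_pos h1 h2, mul_pos (mul_pos h1 h2) h1, mul_pos (mul_pos h1 h2) h2]
  have nonneg : ∀ i ∈ Ico n₀ N, i ∉ S →
      (0 : ℝ) ≤ 4 * (1 / (2 * (i : ℝ) - 1) - 1 / (2 * (i : ℝ) + 1)) := by
    intro i hi _
    have hi' : (1 : ℝ) ≤ i := by exact_mod_cast le_trans hn₀ (mem_Ico.mp hi).1
    have h1 : (0 : ℝ) < 2 * (i : ℝ) - 1 := by linarith
    have : (1 : ℝ) / (2 * (i : ℝ) + 1) ≤ 1 / (2 * (i : ℝ) - 1) :=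
      div_le_div_of_nonneg_left (by norm_num) h1 (by linarith)
    linarith
  have hsub : S ⊆ Ico n₀ N := fun i hi => mem_Ico.mpr (hS i hi)
  rcases lt_or_ge N n₀ with hN | hN
  · -- then `S` is empty
    have : S = ∅ := by
      apply Finset.eq_empty_of_forall_notMem
      intro i hi
      have := hS i hi
      omega
    subst this
    simp only [sum_empty]
    have : (0 : ℝ) < 2 * (n₀ : ℝ) - 1 := by linarith
    positivity
  calc ∑ i ∈ S, ((1 : ℝ) / (2 * (i : ℝ) - 1) ^ 2 + 1 / (2 * (i : ℝ) + 1) ^ 2)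
      ≤ ∑ i ∈ S, 4 * (1 / (2 * (i : ℝ) - 1) - 1 / (2 * (i : ℝ) + 1)) :=
        sum_le_sum fun i hi => pt i (hS i hi).1
    _ ≤ ∑ i ∈ Ico n₀ N, 4 * (1 / (2 * (i : ℝ) - 1) - 1 / (2 * (i : ℝ) + 1)) :=
        sum_le_sum_of_subset_of_nonneg hsub nonneg
    _ = 4 * (1 / (2 * (n₀ : ℝ) - 1) - 1 / (2 * (N : ℝ) - 1)) := by
        rw [← mul_sum, tele N hN]
    _ ≤ 4 / (2 * (n₀ : ℝ) - 1) := by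
        have hN' : (n₀ : ℝ) ≤ N := by exact_mod_cast hN
        have : (0 : ℝ) ≤ 1 / (2 * (N : ℝ) - 1) := by
          apply div_nonneg zero_le_one; linarith
        rw [mul_sub, mul_one_div]
        linarith

/-- The two halves of the odd window are disjoint. -/
theorem oddWindow_disjoint (J : ℕ) :
    Disjoint ((range (J + 1)).image (fun i : ℕ => (2 * (i : ℤ) + 1)))
      ((range (J + 1)).image (fun i : ℕ => -(2 * (i : ℤ) + 1))) := by
  rw [Finset.disjoint_left]
  intro m h1 h2
  simp only [mem_image, mem_range] at h1 h2
  obtain ⟨i, -, rfl⟩ := h1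
  obtain ⟨j, -, hj⟩ := h2
  omega

/-- A sum over the odd window splits into its positive and negative halves. -/
theorem sum_oddWindow (J : ℕ) (f : ℤ → ℝ) :
    ∑ m ∈ oddWindow J, f m =
      ∑ i ∈ range (J + 1), f (2 * (i : ℤ) + 1) + ∑ i ∈ range (J + 1), f (-(2 * (i : ℤ) + 1)) := by
  rw [oddWindow, sum_union (oddWindow_disjoint J), sum_image, sum_image]
  · intro i _ j _ h
    have h' := neg_injective h
    omega
  · intro i _ j _ h
    have h' : (2 * (i : ℤ) + 1) = 2 * (j : ℤ) + 1 := h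
    omega

/-- `# oddWindow J = 2J + 2`. -/
theorem card_oddWindow (J : ℕ) : (oddWindow J).card = 2 * J + 2 := by
  rw [oddWindow, card_union_of_disjoint (oddWindow_disjoint J),
    card_image_of_injective _ (fun i j h => by simpa using h),
    card_image_of_injective _ (fun i j h => by simpa using h), card_range]
  ring

/-- `Σ_{m ∈ window} 1/|m| ≤ 2(1 + log(2J+1))`. -/
theorem sum_oddWindow_inv_abs_le (J : ℕ) :
    ∑ m ∈ oddWindow J, (1 : ℝ) / |(m : ℝ)| ≤ 2 * (1 + Real.log (2 * (J : ℝ) + 1)) := by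
  rw [sum_oddWindow]
  have h1 : ∀ i : ℕ, (1 : ℝ) / |((2 * (i : ℤ) + 1 : ℤ) : ℝ)| = 1 / (2 * (i : ℝ) + 1) := by
    intro i
    push_cast
    rw [abs_of_pos (by positivity)]
  have h2 : ∀ i : ℕ, (1 : ℝ) / |((-(2 * (i : ℤ) + 1) : ℤ) : ℝ)| = 1 / (2 * (i : ℝ) + 1) := by
    intro i
    push_cast
    rw [abs_neg, abs_of_pos (by positivity)]
  simp only [h1, h2]
  have := sum_range_inv_odd_le_log J
  linarith

/-- `Σ_{m ∈ window} 1/m² ≤ 4`. -/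
theorem sum_oddWindow_inv_sq_le (J : ℕ) :
    ∑ m ∈ oddWindow J, (1 : ℝ) / (m : ℝ) ^ 2 ≤ 4 := by
  rw [sum_oddWindow]
  have h1 : ∀ i : ℕ, (1 : ℝ) / ((2 * (i : ℤ) + 1 : ℤ) : ℝ) ^ 2 = 1 / (2 * (i : ℝ) + 1) ^ 2 := by
    intro i
    push_cast
    ring
  have h2 : ∀ i : ℕ, (1 : ℝ) / ((-(2 * (i : ℤ) + 1) : ℤ) : ℝ) ^ 2 = 1 / (2 * (i : ℝ) + 1) ^ 2 := by
    intro i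
    push_cast
    ring
  simp only [h1, h2]
  have := sum_range_inv_odd_sq_le' J
  linarith

/-! ## The integer symbols `E_m` and the sheet sums `G±` -/

namespace LineData

/-- At odd `m`: `m²/4 ≤ |E_m|` (`E_m` is a nonzero integer at `|m| = 1`, and `m² ≤ m² X2 ≤ 4 E_m` beyond). -/
theorem sq_div_four_le_abs_E (d : LineData) (hX2 : 1 ≤ d.X2) (hE : ∀ m : ℤ, m % 2 = 1 → d.E m ≠ 0)
    (hE3 : ∀ m : ℤ, 3 ≤ |m| → m ^ 2 * d.X2 ≤ 4 * d.E m) {m : ℤ} (hm : m % 2 = 1) :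
    (m : ℝ) ^ 2 / 4 ≤ |(d.E m : ℝ)| := by
  by_cases h3 : 3 ≤ |m|
  · have h := hE3 m h3
    have hm2 : m ^ 2 ≤ m ^ 2 * d.X2 := by nlinarith [sq_nonneg m]
    have h' : ((m ^ 2 : ℤ) : ℝ) ≤ ((4 * d.E m : ℤ) : ℝ) := by exact_mod_cast hm2.trans h
    push_cast at h'
    have : (d.E m : ℝ) ≤ |(d.E m : ℝ)| := le_abs_self _
    linarith
  · have h1 : (1 : ℝ) ≤ |(d.E m : ℝ)| := by
      have := Int.one_le_abs (hE m hm)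
      rw [← Int.cast_abs]
      exact_mod_cast this
    have hm1 : m = 1 ∨ m = -1 := by
      rw [not_le, abs_lt] at h3
      omega
    rcases hm1 with rfl | rfl <;> norm_num <;> linarith

/-- `|1/E_{2i+1}| ≤ 4/(2i+1)²`. -/
theorem abs_inv_E_pos_le (d : LineData) (hX2 : 1 ≤ d.X2) (hE : ∀ m : ℤ, m % 2 = 1 → d.E m ≠ 0)
    (hE3 : ∀ m : ℤ, 3 ≤ |m| → m ^ 2 * d.X2 ≤ 4 * d.E m) (i : ℕ) :
    |((d.E (2 * (i : ℤ) + 1) : ℤ) : ℝ)⁻¹| ≤ 4 / (2 * (i : ℝ) + 1) ^ 2 := by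
  have h := d.sq_div_four_le_abs_E hX2 hE hE3 (m := 2 * (i : ℤ) + 1) (by omega)
  push_cast at h
  have hpos : (0 : ℝ) < (2 * (i : ℝ) + 1) ^ 2 / 4 := by positivity
  rw [abs_inv]
  calc |((d.E (2 * (i : ℤ) + 1) : ℤ) : ℝ)|⁻¹ ≤ ((2 * (i : ℝ) + 1) ^ 2 / 4)⁻¹ := inv_anti₀ hpos h
    _ = 4 / (2 * (i : ℝ) + 1) ^ 2 := by rw [inv_div]

/-- `|1/E_{−(2i+1)}| ≤ 4/(2i+1)²`. -/
theorem abs_inv_E_neg_le (d : LineData) (hX2 : 1 ≤ d.X2) (hE : ∀ m : ℤ, m % 2 = 1 → d.E m ≠ 0)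
    (hE3 : ∀ m : ℤ, 3 ≤ |m| → m ^ 2 * d.X2 ≤ 4 * d.E m) (i : ℕ) :
    |((d.E (-(2 * (i : ℤ) + 1)) : ℤ) : ℝ)⁻¹| ≤ 4 / (2 * (i : ℝ) + 1) ^ 2 := by
  have h := d.sq_div_four_le_abs_E hX2 hE hE3 (m := -(2 * (i : ℤ) + 1)) (by omega)
  push_cast at h
  rw [neg_sq] at h
  have hpos : (0 : ℝ) < (2 * (i : ℝ) + 1) ^ 2 / 4 := by positivity
  rw [abs_inv]
  calc |((d.E (-(2 * (i : ℤ) + 1)) : ℤ) : ℝ)|⁻¹ ≤ ((2 * (i : ℝ) + 1) ^ 2 / 4)⁻¹ := inv_anti₀ hpos h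
    _ = 4 / (2 * (i : ℝ) + 1) ^ 2 := by rw [inv_div]

/-- `|G₊| ≤ 5`. -/
theorem abs_Gp_le (d : LineData) (hX2 : 1 ≤ d.X2) (hE : ∀ m : ℤ, m % 2 = 1 → d.E m ≠ 0)
    (hE3 : ∀ m : ℤ, 3 ≤ |m| → m ^ 2 * d.X2 ≤ 4 * d.E m) (J : ℕ) : |d.Gp J| ≤ 5 := by
  unfold LineData.Gp
  calc |∑ i ∈ range (J + 1), ((d.E (2 * (i : ℤ) + 1) : ℤ) : ℝ)⁻¹|
      ≤ ∑ i ∈ range (J + 1), |((d.E (2 * (i : ℤ) + 1) : ℤ) : ℝ)⁻¹| := abs_sum_le_sum_abs _ _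
    _ ≤ ∑ i ∈ range (J + 1), 4 * (1 / (2 * (i : ℝ) + 1) ^ 2) := sum_le_sum fun i _ => by
        rw [mul_one_div]; exact d.abs_inv_E_pos_le hX2 hE hE3 i
    _ = 4 * ∑ i ∈ range (J + 1), 1 / (2 * (i : ℝ) + 1) ^ 2 := by rw [mul_sum]
    _ ≤ 4 * (5 / 4) := by
        have := sum_range_inv_odd_sq_le' J
        linarith
    _ = 5 := by norm_num

/-- `|G₋| ≤ 5`. -/
theorem abs_Gm_le (d : LineData) (hX2 : 1 ≤ d.X2) (hE : ∀ m : ℤ, m % 2 = 1 → d.E m ≠ 0)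
    (hE3 : ∀ m : ℤ, 3 ≤ |m| → m ^ 2 * d.X2 ≤ 4 * d.E m) (J : ℕ) : |d.Gm J| ≤ 5 := by
  unfold LineData.Gm
  calc |∑ i ∈ range (J + 1), ((d.E (-(2 * (i : ℤ) + 1)) : ℤ) : ℝ)⁻¹|
      ≤ ∑ i ∈ range (J + 1), |((d.E (-(2 * (i : ℤ) + 1)) : ℤ) : ℝ)⁻¹| := abs_sum_le_sum_abs _ _
    _ ≤ ∑ i ∈ range (J + 1), 4 * (1 / (2 * (i : ℝ) + 1) ^ 2) := sum_le_sum fun i _ => by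
        rw [mul_one_div]; exact d.abs_inv_E_neg_le hX2 hE hE3 i
    _ = 4 * ∑ i ∈ range (J + 1), 1 / (2 * (i : ℝ) + 1) ^ 2 := by rw [mul_sum]
    _ ≤ 4 * (5 / 4) := by
        have := sum_range_inv_odd_sq_le' J
        linarith
    _ = 5 := by norm_num

end LineData

end Summit.AnomalousDissipation.AnomalousDissipation.Theorems.KolmogorovFloor.Response
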